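/-
Copyright: lit-balaban Phase-2 proof seat p02 (gen 13).  Statement-level skeleton of a published paper; no proof claims beyond what
the kernel checks below.
-/
import Literature.MathematicalPhysics.QuantumFieldTheory.BalabanImbrieJaffe1984to88.BIJ88W1PrimeCurlIneq547RSchedTorus
import Literature.MathematicalPhysics.QuantumFieldTheory.BalabanImbrieJaffe1984to88.BIJ88W1HkPart544DivTorus

/-!
# `BalabanImbrieJaffe1984to88.BIJ88W1CurlIneq547Torus` — T. Bałaban, J. Imbrie, A. Jaffe, *Effective action and cluster properties of the
abelian Higgs model*, Commun. Math. Phys. **114** (1988) 257–315 [BalabanImbrieJaffe1988], §5.4 p. 282 [PDF 26]: **THE OUTPUT DERIVATIVES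
`∂w₁`, `∂*w₁` OF `w₁ = w′₁ + H_k□ − H_{k,loc}` OBEY THE p. 282 BOUNDS, ON ALL TORI OF THE SERIES FOR THE KERNELS OF RECORD** — the print's
*"We have put w₁ = w′₁ + H_k□ − H_{k,loc}, and it satisfies the same bounds as w′₁"*, where the bounds of `w′₁` are the three displayed /
named ones *"|(∂w′₁)(p,b′)| ≦ … ≦ e^{−cr(e_k)}e^{−c dist(p,b′)}, and similarly for w′₁, ∂*w′₁"*.  The VALUE member of this sentence is p02
gen 12's `BIJ88W1Ineq547Torus.ineq547_w1_allTori`; this file supplies the two DERIVATIVE members, for the rows in `□₀` exactly as the value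
member is typed (row weight `χ₀` with the collar clause «we use w′₁(b,b′) only for b in □₀ ⊂ □»), BY ADDITIVITY of
* p08 gen 10's `BIJ88W1Prime543CurlBoundTorus.ineq547_dw1P_allTori` / `ineq547_sw1P_allTori` (`∂w′₁`, `∂*w′₁`, all tori, hypothesis-free), and
* p02 gen 8's `BIJ88W1HkPart544DivTorus.ineq547_w1HkPart3_allTori`, members 2–3 (`∂`, `∂*` of the `H`-part `H_kχ□ − H_{k,loc}`),
through p02 gen 12's `BIJ88W1Ineq547Torus.ineq547_add` / `ineq547_rowWeight` and the linearity of `∂ = curl`, `∂* = diverg`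
(`LatticeFieldCalculus.curl_add`; `diverg_add_apply` here).  With the value member this completes the triple (`w₁`, `∂w₁`, `∂*w₁`) BY NAME
(`ineq547_w1_three_allTori`), and §4 gives the forms with the PRINTED radii `ρ_j = r(e_j)` for `e_k` small (p08's `rSched_threshold_gap`).

statement-level skeleton of published theorems with citation tags; proofs where landed; nothing here is a claim about the Yang–Mills mass gap

PDF held: `paper:balaban1988-cmp114-bij-abelian-higgs-effective-action` (journal page = PDF page + 256).  Page of record p. 282 [PDF 26]
(image `HOME/lit-balaban-r16/renders/cmp114/original-p026-x2.png`, read by p02 gen 12 and r16; the sentence quoted below is the one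
typed in `BIJ88W1Ineq547Torus`, unchanged).

CITATION HEADER (lean-in-tree rule).  Part of the lit-balaban TYPED SKELETON (HOME `run/shared/lean/pub/lit-balaban/`), Phase-2 proof seat
p02 (gen 13), unit `lit-balaban-p02`; free-target protocol G.5-34(d), TAKING line HOME/STATUS.md 2026-08-22T04:44:33Z.  WHAT IS REPRODUCED =
SKELETON row **C2.Eq5.4.7** (owner r16, referee ref-5; head `proved` since ROWS-C2-part2 v2.84), the p. 282 sentence on `w₁`, kind «model
instance for the kernels of record», MEMBER ONLY (no head change asked).  Decls used BY NAME (nothing restated): p08's `dw1P`, `sw1P`,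
`ineq547_dw1P_allTori`, `ineq547_sw1P_allTori`, `rSched_threshold_gap`; p02's `w1P`, `ineq547_w1P_allTori`, `ineq547_w1_allTori`,
`ineq547_add`, `ineq547_rowWeight`, `ineq547_w1HkPart3_allTori`; p11's `HkE`; p13's (2.1) `cutoff`; r18's `loc`, `rSched`, `eK`; r16's
typed `Ineq547`.

THE PRINTED TEXT (p. 282 [PDF 26], verbatim): *"… we find that |(∂w′₁)(p,b′)| ≦ Σ_{j=1}^{k−1}(L^jη)^{−1−(d−2)−1+(d−2)}e^{−cr(e_j)}e^{−c dist(p,b′)}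
≦ e^{−cr(e_k)}e^{−c dist(p,b′)}, and similarly for w′₁, ∂*w′₁. Also, w′₁ is finite ranged in the sense that w′₁ = w′₁□; we use w′₁(b,b′) only
for b in □₀ ⊂ □. … We have put w₁ = w′₁ + H_k□ − H_{k,loc}, and it satisfies the same bounds as w′₁."*

WHAT IS PROVED (0 `sorry`, standard axioms; theorems only — proof lane):
* §1 `ineq547_mono` (the (5.4.7)-shape is antitone in the rate `c` for `R, dist ≥ 0`), `diverg_add_apply` (`∂*` is additive, pointwise),
  `curl_w1_eq` / `diverg_w1_eq` (the output curl / divergence of the column `b ↦ w₁(b,b′)` splits as `∂w′₁ + ∂(H-part)`, `∂*w′₁ + ∂*(H-part)`).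
* §2 **`ineq547_dw1_allTori`** — `∃ c θ₀ ρ₁ > 0 ∀` torus (`P.d = d`, `P.L = L`) `∀ k ≤ m + K ∀ ρ` (`ρ_k ≥ ρ₁`, gap `θ₀`) `∀ c′ ≠ 0, w > 0 ∀ |χ□| ≤ 1
  ∀ |χ₀| ≤ 1` with the collar clause (`χ₀(x) ≠ 0 ∧ dist_k(x,b′) ≤ ρ_k/8 + 2 ⟹ χ□(b′) = 1`):
  `Ineq547 (TPlaq P 0) (PBond P k) (fun q b′ ↦ χ₀(q₋)·(∂^η w₁(·,b′))(q)) dist_k c (ρ k)`, `w₁(·,b′) = w′₁(·,b′) + H_k(·,b′)χ□(b′) − H_{k,loc}(·,b′)`.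
* §3 **`ineq547_sw1_allTori`** — the same on `TSite P 0` for `χ₀(x)·(∂^{η*} w₁(·,b′))(x)`.
  **`ineq547_w1_three_allTori`** — ONE `(c, θ₀, ρ₁)` for the three members (`w₁`, `∂w₁`, `∂*w₁`) at once.
* §4 **`ineq547_dw1_allTori_rSched`**, **`ineq547_sw1_allTori_rSched`** — with the PRINTED radii `rSched L ε e r d` (`ρ_j = r(e_j)`,
  (2.2)–(2.3)): ONE `c > 0`, and for all `e_k` in a punctured right neighbourhood of `0` (uniformly in the torus, `k ≤ m + K`, `ε, e > 0`
  realizing `e_k`, the weights, cube functions and row weights) the two shapes at radius `r(e_k)` (`2 ≤ d < 4`, `r > 1`).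
HONEST SCOPE.  (i) Rows in `□₀` only (row weight `χ₀` with the collar clause), as the value member and as the print uses `w₁`; the `H`-part
needs the collar (`(1 − ζ_k)H_k` is small only beyond `ρ_k/16` of the row).  The row weight multiplies the DERIVATIVE (`χ₀(q₋)·(∂w₁)(q,b′)`),
it is not differentiated — exactly as in `ineq547_w1HkPart3_allTori`.  (ii) The `e_k`-smallness of §4 is an `∀ᶠ … in 𝓝[>] 0` statement
(threshold not computed); `d < 4` and `r > 1` as printed.  (iii) `U = 1`, real abelian fields, torus of the series, standing range `k ≤ m + K`;
constants explicit upstream, not optimal (the common rate is `min/2` of the members' rates).  (iv) No `def`, no new named fact; NOT summit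
progress.  Unit `lit-balaban-p02` (literature-prover-lit-balaban-p02-g13-0), 2026-08-22.
-/

open scoped BigOperators RealInnerProductSpace
open scoped Topology
open Filter

namespace Literature.MathematicalPhysics.QuantumFieldTheory.BalabanImbrieJaffe1984to88.BIJ88W1CurlIneq547Torus

open Balaban1983to89 hiding Site Plaq
open Balaban1983to89.LatticeFieldCalculus
open BIJ85Prop521Torus BIJ85Prop522Torus BIJ85Sigma422Eta
open BIJ85Sect7Statements BIJ85Ineq722Torus
open BIJ88Sect2Statements (loc eK rLen)
open BIJ88Sect5StatementsPart2 (Ineq547)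
open BIJ88Cutoffs21 (cutoff)
open BIJ88CurlyDkLocTorus (rSched)
open BIJ88W1Prime543Torus (w1P)
open BIJ88W1Prime543CurlDivTorus (dw1P sw1P)
open BIJ88W1Prime543CurlBoundTorus (ineq547_dw1P_allTori ineq547_sw1P_allTori)
open BIJ88W1PrimeCurlIneq547RSchedTorus (rSched_threshold_gap)
open BIJ88W1Ineq547Torus (ineq547_rowWeight ineq547_add ineq547_w1_allTori)
open BIJ88W1HkPart544DivTorus (ineq547_w1HkPart3_allTori)
-- inside this namespace the bare `Site`/`Plaq` are the `ℤ^d` carriers of the QFT root; the torus ones are renamed: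
open Balaban1983to89 renaming Site → TSite, Plaq → TPlaq

noncomputable section

variable {P : Params}

/-! ## §1  Small algebra: monotonicity of the shape in the rate, additivity of `∂`, `∂*` -/

/-- the (5.4.7)-shape is ANTITONE in the rate: `c′ ≤ c`, `R ≥ 0`, `dist ≥ 0` ⟹ `Ineq547 … c R → Ineq547 … c′ R`.
[cite: BalabanImbrieJaffe1988, (5.4.7) p.282] -/
theorem ineq547_mono {α β : Type} {f : α → β → ℝ} {dist : α → β → ℝ} (hdist : ∀ x b, 0 ≤ dist x b) {c c' R : ℝ}
    (hc : c' ≤ c) (hR : 0 ≤ R) (hf : Ineq547 α β f dist c R) : Ineq547 α β f dist c' R := by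
  intro x b
  refine (hf x b).trans ?_
  exact mul_le_mul (Real.exp_le_exp.2 (by nlinarith)) (Real.exp_le_exp.2 (by nlinarith [hdist x b]))
    (Real.exp_pos _).le (Real.exp_pos _).le

/-- `∂*` is additive, pointwise: `(∂*(A + B))(x) = (∂*A)(x) + (∂*B)(x)`. [cite: Balaban1984PropagatorsI, (1.21) p.21] -/
theorem diverg_add_apply {j : ℕ} (c : ℝ) (A B : PBond P j → ℝ) (x : TSite P j) :
    diverg c (fun b => A b + B b) x = diverg c A x + diverg c B x := by
  simp only [diverg, ← Finset.sum_add_distrib, smul_eq_mul]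
  refine Finset.sum_congr rfl fun μ _ => ?_
  ring

/-- `∂` is additive, pointwise (`LatticeFieldCalculus.curl_add`). [cite: Balaban1984PropagatorsI, (1.2) p.18] -/
theorem curl_add_apply {j : ℕ} (c : ℝ) (A B : PBond P j → ℝ) (q : TPlaq P j) :
    curl c (fun b => A b + B b) q = curl c A q + curl c B q :=
  curl_add c A B q

/-- THE OUTPUT CURL OF THE COLUMN `b ↦ w₁(b,b′) = w′₁(b,b′) + K(b,b′)` SPLITS: `(∂w₁(·,b′))(q) = (∂w′₁)(q,b′) + (∂K(·,b′))(q)` (p08's `dw1P`).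
[cite: BalabanImbrieJaffe1988, (5.4.3) p.282] -/
theorem curl_w1_eq (hd : 2 ≤ P.d) (ρ : ℕ → ℝ) (k : ℕ) (χb : PBond P k → ℝ) (K : PBond P 0 → PBond P k → ℝ)
    (q : TPlaq P 0) (b' : PBond P k) :
    curl ((P.L : ℝ) ^ k) (fun b : PBond P 0 => w1P hd ρ k χb b b' + K b b') q =
      dw1P hd ρ k χb q b' + curl ((P.L : ℝ) ^ k) (fun b : PBond P 0 => K b b') q :=
  curl_add _ (fun b : PBond P 0 => w1P hd ρ k χb b b') (fun b => K b b') q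

/-- THE OUTPUT DIVERGENCE OF THE COLUMN `b ↦ w₁(b,b′) = w′₁(b,b′) + K(b,b′)` SPLITS: `(∂*w₁(·,b′))(x) = (∂*w′₁)(x,b′) + (∂*K(·,b′))(x)`
(p08's `sw1P`). [cite: BalabanImbrieJaffe1988, (5.4.3) p.282] -/
theorem diverg_w1_eq (hd : 2 ≤ P.d) (ρ : ℕ → ℝ) (k : ℕ) (χb : PBond P k → ℝ) (K : PBond P 0 → PBond P k → ℝ)
    (x : TSite P 0) (b' : PBond P k) :
    diverg ((P.L : ℝ) ^ k) (fun b : PBond P 0 => w1P hd ρ k χb b b' + K b b') x =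
      sw1P hd ρ k χb x b' + diverg ((P.L : ℝ) ^ k) (fun b : PBond P 0 => K b b') x :=
  diverg_add_apply _ (fun b : PBond P 0 => w1P hd ρ k χb b b') (fun b => K b b') x

/-- `dist_k ≥ 0` on the torus (unit-lattice distance in units of `T₁^{(k)}`). [folklore] -/
private theorem distEU_nonneg'' (k : ℕ) (x : TSite P 0) (y : TSite P k) : 0 ≤ distEU P k x y :=
  div_nonneg (Nat.cast_nonneg _) (pow_pos P.cast_L_pos k).le

/-! ## §2  `∂w₁` for the rows in `□₀`, all tori -/

/-- **`∂w₁` OBEYS THE p. 282 BOUND, ON ALL TORI OF THE SERIES, HYPOTHESIS-FREE** (`2 ≤ d`, `L` odd `> 1`): ONE `(c, θ₀, ρ₁)` such that for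
every torus (`P.d = d`, `P.L = L`), every `k ≤ m + K`, every radius schedule `ρ` with `ρ_k ≥ ρ₁` and scale gap `ρ_j ≥ ρ_k + (k−j)θ₀`, all
weights `w > 0`, `c′ ≠ 0` of p11's `HkE`, every cube function `|χ□| ≤ 1` and row weight `|χ₀| ≤ 1` carrying the collar clause
(`χ₀(x) ≠ 0 ∧ dist_k(x,b′) ≤ ρ_k/8 + 2 ⟹ χ□(b′) = 1`), r16's typed shape holds for the output curl of the rows in `□₀` of
`w₁ = w′₁ + H_kχ□ − H_{k,loc}`: `Ineq547 (T_η-plaquettes) (T₁^{(k)}-bonds) (χ₀(q₋)·(∂^η w₁(·,b′))(q)) dist_k c ρ_k` — p08's `ineq547_dw1P_allTori`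
+ member 2 of p02 g8's `ineq547_w1HkPart3_allTori` + `ineq547_add`. [cite: BalabanImbrieJaffe1988, (5.4.7) p.282] -/
theorem ineq547_dw1_allTori {d L : ℕ} (hd : 2 ≤ d) (hL : Odd L ∧ 1 < L) :
    ∃ c θ₀ ρ₁ : ℝ, 0 < c ∧ 0 < θ₀ ∧ 0 < ρ₁ ∧ ∀ (P : Params) (hPd : P.d = d) (_ : P.L = L) (k : ℕ) (_ : k ≤ P.m + P.K) (ρ : ℕ → ℝ),
      ρ₁ ≤ ρ k → (∀ j < k, ρ k + ((k - j : ℕ) : ℝ) * θ₀ ≤ ρ j) →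
      ∀ (c' : ℝ), c' ≠ 0 → ∀ (w : ℝ), 0 < w → ∀ (χb : PBond P k → ℝ), (∀ b', |χb b'| ≤ 1) →
      ∀ (χ₀ : TSite P 0 → ℝ), (∀ x, |χ₀ x| ≤ 1) →
      (∀ (x : TSite P 0) (b' : PBond P k), χ₀ x ≠ 0 → distEU P k x b'.src ≤ ρ k / 8 + 2 → χb b' = 1) →
        Ineq547 (TPlaq P 0) (PBond P k)
          (fun q b' => χ₀ q.src * curl ((P.L : ℝ) ^ k) (fun b : PBond P 0 =>
              w1P (hPd ▸ hd) ρ k χb b b' +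
                (WithLp.ofLp (HkE P w c' k (toEj P k (Pi.single b' 1))) b * χb b' -
                  loc (cutoff (ρ k / 16) (ρ k / 8) (fun (b : PBond P 0) (b' : PBond P k) => distEU P k b.src b'.src))
                    (fun b b'' => WithLp.ofLp (HkE P w c' k (toEj P k (Pi.single b'' 1))) b) b b')) q)
          (fun q b' => distEU P k q.src b'.src) c (ρ k) := by
  obtain ⟨ca, θ₀, ρ₁, hca, hθ₀, hρ₁, hA⟩ := ineq547_dw1P_allTori hd hL
  obtain ⟨cb, r₁, hcb, hB⟩ := ineq547_w1HkPart3_allTori (d := d) (L := L) (le_trans one_le_two hd) hL one_pos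
  refine ⟨min ca cb / 2, θ₀, max ρ₁ (max r₁ (2 * Real.log 2 / min ca cb)), half_pos (lt_min hca hcb), hθ₀,
    lt_of_lt_of_le hρ₁ (le_max_left _ _), fun P hPd hPL k hk ρ hρk hgap c' hc' w hw χb hχb χ₀ hχ₀ hcollar => ?_⟩
  have h1 := hA P hPd hPL k hk ρ ((le_max_left _ _).trans hρk) hgap χb hχb
  have h2 := (hB P hPd hPL k hk c' hc' w hw (ρ k) ((le_max_left _ _).trans ((le_max_right _ _).trans hρk)) χb hχb χ₀ hχ₀
    hcollar).2.1
  have hR : 2 * Real.log 2 / min ca cb ≤ ρ k := (le_max_right _ _).trans ((le_max_right _ _).trans hρk)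
  have h3 := ineq547_add (fun (q : TPlaq P 0) (b' : PBond P k) => distEU_nonneg'' k q.src b'.src) hca hcb hR
    (ineq547_rowWeight h1 fun q : TPlaq P 0 => hχ₀ q.src) h2
  intro q b'
  have e := curl_w1_eq (hPd ▸ hd) ρ k χb (fun b b' =>
    WithLp.ofLp (HkE P w c' k (toEj P k (Pi.single b' 1))) b * χb b' -
      loc (cutoff (ρ k / 16) (ρ k / 8) (fun (b : PBond P 0) (b' : PBond P k) => distEU P k b.src b'.src))
        (fun b b'' => WithLp.ofLp (HkE P w c' k (toEj P k (Pi.single b'' 1))) b) b b') q b'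
  have h := h3 q b'
  beta_reduce
  beta_reduce at h
  rw [e, mul_add]
  exact h

/-! ## §3  `∂*w₁` for the rows in `□₀`, all tori; the three members at once -/

/-- **`∂*w₁` OBEYS THE p. 282 BOUND, ON ALL TORI OF THE SERIES, HYPOTHESIS-FREE** (`2 ≤ d`, `L` odd `> 1`): as `ineq547_dw1_allTori`, for the
output divergence of the rows in `□₀` of `w₁ = w′₁ + H_kχ□ − H_{k,loc}`:
`Ineq547 (T_η-sites) (T₁^{(k)}-bonds) (χ₀(x)·(∂^{η*} w₁(·,b′))(x)) dist_k c ρ_k` — p08's `ineq547_sw1P_allTori` + member 3 of p02 g8's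
`ineq547_w1HkPart3_allTori` + `ineq547_add`. [cite: BalabanImbrieJaffe1988, (5.4.7) p.282] -/
theorem ineq547_sw1_allTori {d L : ℕ} (hd : 2 ≤ d) (hL : Odd L ∧ 1 < L) :
    ∃ c θ₀ ρ₁ : ℝ, 0 < c ∧ 0 < θ₀ ∧ 0 < ρ₁ ∧ ∀ (P : Params) (hPd : P.d = d) (_ : P.L = L) (k : ℕ) (_ : k ≤ P.m + P.K) (ρ : ℕ → ℝ),
      ρ₁ ≤ ρ k → (∀ j < k, ρ k + ((k - j : ℕ) : ℝ) * θ₀ ≤ ρ j) →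
      ∀ (c' : ℝ), c' ≠ 0 → ∀ (w : ℝ), 0 < w → ∀ (χb : PBond P k → ℝ), (∀ b', |χb b'| ≤ 1) →
      ∀ (χ₀ : TSite P 0 → ℝ), (∀ x, |χ₀ x| ≤ 1) →
      (∀ (x : TSite P 0) (b' : PBond P k), χ₀ x ≠ 0 → distEU P k x b'.src ≤ ρ k / 8 + 2 → χb b' = 1) →
        Ineq547 (TSite P 0) (PBond P k)
          (fun x b' => χ₀ x * diverg ((P.L : ℝ) ^ k) (fun b : PBond P 0 =>
              w1P (hPd ▸ hd) ρ k χb b b' +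
                (WithLp.ofLp (HkE P w c' k (toEj P k (Pi.single b' 1))) b * χb b' -
                  loc (cutoff (ρ k / 16) (ρ k / 8) (fun (b : PBond P 0) (b' : PBond P k) => distEU P k b.src b'.src))
                    (fun b b'' => WithLp.ofLp (HkE P w c' k (toEj P k (Pi.single b'' 1))) b) b b')) x)
          (fun x b' => distEU P k x b'.src) c (ρ k) := by
  obtain ⟨ca, θ₀, ρ₁, hca, hθ₀, hρ₁, hA⟩ := ineq547_sw1P_allTori hd hL
  obtain ⟨cb, r₁, hcb, hB⟩ := ineq547_w1HkPart3_allTori (d := d) (L := L) (le_trans one_le_two hd) hL one_pos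
  refine ⟨min ca cb / 2, θ₀, max ρ₁ (max r₁ (2 * Real.log 2 / min ca cb)), half_pos (lt_min hca hcb), hθ₀,
    lt_of_lt_of_le hρ₁ (le_max_left _ _), fun P hPd hPL k hk ρ hρk hgap c' hc' w hw χb hχb χ₀ hχ₀ hcollar => ?_⟩
  have h1 := hA P hPd hPL k hk ρ ((le_max_left _ _).trans hρk) hgap χb hχb
  have h2 := (hB P hPd hPL k hk c' hc' w hw (ρ k) ((le_max_left _ _).trans ((le_max_right _ _).trans hρk)) χb hχb χ₀ hχ₀
    hcollar).2.2
  have hR : 2 * Real.log 2 / min ca cb ≤ ρ k := (le_max_right _ _).trans ((le_max_right _ _).trans hρk)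
  have h3 := ineq547_add (fun (x : TSite P 0) (b' : PBond P k) => distEU_nonneg'' k x b'.src) hca hcb hR
    (ineq547_rowWeight h1 fun x : TSite P 0 => hχ₀ x) h2
  intro x b'
  have e := diverg_w1_eq (hPd ▸ hd) ρ k χb (fun b b' =>
    WithLp.ofLp (HkE P w c' k (toEj P k (Pi.single b' 1))) b * χb b' -
      loc (cutoff (ρ k / 16) (ρ k / 8) (fun (b : PBond P 0) (b' : PBond P k) => distEU P k b.src b'.src))
        (fun b b'' => WithLp.ofLp (HkE P w c' k (toEj P k (Pi.single b'' 1))) b) b b') x b'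
  have h := h3 x b'
  beta_reduce
  beta_reduce at h
  rw [e, mul_add]
  exact h

/-- **THE THREE MEMBERS AT ONCE — «w₁ … satisfies the same bounds as w′₁» (as `w′₁`, `∂w′₁`, `∂*w′₁`), ALL TORI, ONE SET OF CONSTANTS**
(`2 ≤ d`, `L` odd `> 1`): ONE `(c, θ₀, ρ₁)` such that, under the data of `ineq547_dw1_allTori`, the rows in `□₀` of `w₁`, of `∂w₁` and of
`∂*w₁` obey r16's `Ineq547` at rate `c` and radius `ρ_k` simultaneously — the value member is p02 gen 12's `ineq547_w1_allTori`.
[cite: BalabanImbrieJaffe1988, (5.4.7) p.282] -/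
theorem ineq547_w1_three_allTori {d L : ℕ} (hd : 2 ≤ d) (hL : Odd L ∧ 1 < L) :
    ∃ c θ₀ ρ₁ : ℝ, 0 < c ∧ 0 < θ₀ ∧ 0 < ρ₁ ∧ ∀ (P : Params) (hPd : P.d = d) (_ : P.L = L) (k : ℕ) (_ : k ≤ P.m + P.K) (ρ : ℕ → ℝ),
      ρ₁ ≤ ρ k → (∀ j < k, ρ k + ((k - j : ℕ) : ℝ) * θ₀ ≤ ρ j) →
      ∀ (c' : ℝ), c' ≠ 0 → ∀ (w : ℝ), 0 < w → ∀ (χb : PBond P k → ℝ), (∀ b', |χb b'| ≤ 1) →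
      ∀ (χ₀ : TSite P 0 → ℝ), (∀ x, |χ₀ x| ≤ 1) →
      (∀ (x : TSite P 0) (b' : PBond P k), χ₀ x ≠ 0 → distEU P k x b'.src ≤ ρ k / 8 + 2 → χb b' = 1) →
        Ineq547 (PBond P 0) (PBond P k)
          (fun b b' => χ₀ b.src * w1P (hPd ▸ hd) ρ k χb b b' +
            χ₀ b.src * (WithLp.ofLp (HkE P w c' k (toEj P k (Pi.single b' 1))) b * χb b' -
              loc (cutoff (ρ k / 16) (ρ k / 8) (fun (b : PBond P 0) (b' : PBond P k) => distEU P k b.src b'.src))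
                (fun b b'' => WithLp.ofLp (HkE P w c' k (toEj P k (Pi.single b'' 1))) b) b b'))
          (fun b b' => distEU P k b.src b'.src) c (ρ k) ∧
        Ineq547 (TPlaq P 0) (PBond P k)
          (fun q b' => χ₀ q.src * curl ((P.L : ℝ) ^ k) (fun b : PBond P 0 =>
              w1P (hPd ▸ hd) ρ k χb b b' +
                (WithLp.ofLp (HkE P w c' k (toEj P k (Pi.single b' 1))) b * χb b' -
                  loc (cutoff (ρ k / 16) (ρ k / 8) (fun (b : PBond P 0) (b' : PBond P k) => distEU P k b.src b'.src))
                    (fun b b'' => WithLp.ofLp (HkE P w c' k (toEj P k (Pi.single b'' 1))) b) b b')) q)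
          (fun q b' => distEU P k q.src b'.src) c (ρ k) ∧
        Ineq547 (TSite P 0) (PBond P k)
          (fun x b' => χ₀ x * diverg ((P.L : ℝ) ^ k) (fun b : PBond P 0 =>
              w1P (hPd ▸ hd) ρ k χb b b' +
                (WithLp.ofLp (HkE P w c' k (toEj P k (Pi.single b' 1))) b * χb b' -
                  loc (cutoff (ρ k / 16) (ρ k / 8) (fun (b : PBond P 0) (b' : PBond P k) => distEU P k b.src b'.src))
                    (fun b b'' => WithLp.ofLp (HkE P w c' k (toEj P k (Pi.single b'' 1))) b) b b')) x)
          (fun x b' => distEU P k x b'.src) c (ρ k) := by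
  obtain ⟨c₁, θ₁, r₁, hc₁, hθ₁, hr₁, h₁⟩ := ineq547_w1_allTori hd hL
  obtain ⟨c₂, θ₂, r₂, hc₂, hθ₂, hr₂, h₂⟩ := ineq547_dw1_allTori hd hL
  obtain ⟨c₃, θ₃, r₃, hc₃, hθ₃, hr₃, h₃⟩ := ineq547_sw1_allTori hd hL
  refine ⟨min c₁ (min c₂ c₃), max θ₁ (max θ₂ θ₃), max r₁ (max r₂ r₃), lt_min hc₁ (lt_min hc₂ hc₃),
    lt_of_lt_of_le hθ₁ (le_max_left _ _), lt_of_lt_of_le hr₁ (le_max_left _ _),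
    fun P hPd hPL k hk ρ hρk hgap c' hc' w hw χb hχb χ₀ hχ₀ hcollar => ?_⟩
  have hρ0 : 0 ≤ ρ k := le_trans (le_trans hr₁.le (le_max_left _ _)) hρk
  -- a larger gap constant implies each member's gap
  have hgap' : ∀ {θ : ℝ}, θ ≤ max θ₁ (max θ₂ θ₃) → ∀ j < k, ρ k + ((k - j : ℕ) : ℝ) * θ ≤ ρ j := by
    intro θ hθ j hj
    have hm : 0 ≤ ((k - j : ℕ) : ℝ) := Nat.cast_nonneg _
    have := hgap j hj
    nlinarith [mul_le_mul_of_nonneg_left hθ hm]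
  refine ⟨?_, ?_, ?_⟩
  · exact ineq547_mono (fun (b : PBond P 0) (b' : PBond P k) => distEU_nonneg'' k b.src b'.src) (min_le_left _ _) hρ0
      (h₁ P hPd hPL k hk ρ ((le_max_left _ _).trans hρk) (hgap' (le_max_left _ _)) c' hc' w hw χb hχb χ₀ hχ₀ hcollar)
  · exact ineq547_mono (fun (q : TPlaq P 0) (b' : PBond P k) => distEU_nonneg'' k q.src b'.src)
      ((min_le_right _ _).trans (min_le_left _ _)) hρ0
      (h₂ P hPd hPL k hk ρ ((le_max_left _ _).trans ((le_max_right _ _).trans hρk))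
        (hgap' ((le_max_left _ _).trans (le_max_right _ _))) c' hc' w hw χb hχb χ₀ hχ₀ hcollar)
  · exact ineq547_mono (fun (x : TSite P 0) (b' : PBond P k) => distEU_nonneg'' k x b'.src)
      ((min_le_right _ _).trans (min_le_right _ _)) hρ0
      (h₃ P hPd hPL k hk ρ ((le_max_right _ _).trans ((le_max_right _ _).trans hρk))
        (hgap' ((le_max_right _ _).trans (le_max_right _ _))) c' hc' w hw χb hχb χ₀ hχ₀ hcollar)

/-! ## §4  The printed radii `ρ_j = r(e_j)` ((2.2)–(2.3)), `e_k` small -/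

/-- **(5.4.7)-SHAPE FOR `∂w₁` WITH THE PRINTED RADII, ALL TORI, `e_k` SMALL** (`2 ≤ d < 4`, `L` odd `> 1`, `r > 1`): with the radius schedule
of the paper `ρ_j = r(e_j)` (r18's `rSched`, (2.2)–(2.3): `e_j = (L^jε)^{(4−d)/2}e`), there is ONE `c > 0` such that for all sufficiently
small `e_k > 0` (a punctured right neighbourhood of `0`, uniform in the torus, in `k ≤ m + K`, in `ε, e > 0` realizing `e_k`, in the weights
of `HkE`, the cube function `|χ□| ≤ 1` and the row weight `|χ₀| ≤ 1` with the collar clause at radius `r(e_k)/8 + 2`), the output curl of the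
rows in `□₀` of `w₁` obeys `|χ₀(q₋)(∂w₁(·,b′))(q)| ≤ e^{−c·r(e_k)}e^{−c·dist_k(q₋,b′₋)}` — `ineq547_dw1_allTori` at the printed schedule via
p08's `rSched_threshold_gap`. [cite: BalabanImbrieJaffe1988, (5.4.7) p.282] -/
theorem ineq547_dw1_allTori_rSched {d L : ℕ} (hd : 2 ≤ d) (hd4 : d < 4) (hL : Odd L ∧ 1 < L) {r : ℝ} (hr : 1 < r) :
    ∃ c : ℝ, 0 < c ∧ ∀ᶠ ek in 𝓝[>] (0 : ℝ), ∀ (P : Params) (hPd : P.d = d) (_ : P.L = L) (k : ℕ) (_ : k ≤ P.m + P.K) (ε e : ℝ),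
      0 < ε → 0 < e → eK (L : ℝ) ε e d k = ek →
      ∀ (c' : ℝ), c' ≠ 0 → ∀ (w : ℝ), 0 < w → ∀ (χb : PBond P k → ℝ), (∀ b', |χb b'| ≤ 1) →
      ∀ (χ₀ : TSite P 0 → ℝ), (∀ x, |χ₀ x| ≤ 1) →
      (∀ (x : TSite P 0) (b' : PBond P k), χ₀ x ≠ 0 → distEU P k x b'.src ≤ rSched (L : ℝ) ε e r d k / 8 + 2 → χb b' = 1) →
        Ineq547 (TPlaq P 0) (PBond P k)
          (fun q b' => χ₀ q.src * curl ((P.L : ℝ) ^ k) (fun b : PBond P 0 =>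
              w1P (hPd ▸ hd) (rSched (L : ℝ) ε e r d) k χb b b' +
                (WithLp.ofLp (HkE P w c' k (toEj P k (Pi.single b' 1))) b * χb b' -
                  loc (cutoff (rSched (L : ℝ) ε e r d k / 16) (rSched (L : ℝ) ε e r d k / 8)
                      (fun (b : PBond P 0) (b' : PBond P k) => distEU P k b.src b'.src))
                    (fun b b'' => WithLp.ofLp (HkE P w c' k (toEj P k (Pi.single b'' 1))) b) b b')) q)
          (fun q b' => distEU P k q.src b'.src) c (rSched (L : ℝ) ε e r d k) := by
  obtain ⟨c, θ₀, ρ₁, hc, -, -, hA⟩ := ineq547_dw1_allTori hd hL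
  have hL1 : (1 : ℝ) < (L : ℝ) := by exact_mod_cast hL.2
  refine ⟨c, hc, ?_⟩
  filter_upwards [rSched_threshold_gap hd4 hL1 hr ρ₁ θ₀] with ek hek
  intro P hPd hPL k hk ε e hε he hekk c' hc' w hw χb hχb χ₀ hχ₀ hcollar
  obtain ⟨hρ, hgap⟩ := hek k ε e hε he hekk
  exact hA P hPd hPL k hk (rSched (L : ℝ) ε e r d) hρ hgap c' hc' w hw χb hχb χ₀ hχ₀ hcollar

/-- **(5.4.7)-SHAPE FOR `∂*w₁` WITH THE PRINTED RADII, ALL TORI, `e_k` SMALL** (`2 ≤ d < 4`, `L` odd `> 1`, `r > 1`): ONE `c > 0` such that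
for all sufficiently small `e_k > 0` (uniformly in the torus, `k ≤ m + K`, `ε, e > 0` realizing `e_k`, the weights, `|χ□| ≤ 1`, `|χ₀| ≤ 1`
with the collar clause at radius `r(e_k)/8 + 2`), the output divergence of the rows in `□₀` of `w₁` obeys
`|χ₀(x)(∂*w₁(·,b′))(x)| ≤ e^{−c·r(e_k)}e^{−c·dist_k(x,b′₋)}` — `ineq547_sw1_allTori` at the printed schedule via p08's `rSched_threshold_gap`.
[cite: BalabanImbrieJaffe1988, (5.4.7) p.282] -/
theorem ineq547_sw1_allTori_rSched {d L : ℕ} (hd : 2 ≤ d) (hd4 : d < 4) (hL : Odd L ∧ 1 < L) {r : ℝ} (hr : 1 < r) :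
    ∃ c : ℝ, 0 < c ∧ ∀ᶠ ek in 𝓝[>] (0 : ℝ), ∀ (P : Params) (hPd : P.d = d) (_ : P.L = L) (k : ℕ) (_ : k ≤ P.m + P.K) (ε e : ℝ),
      0 < ε → 0 < e → eK (L : ℝ) ε e d k = ek →
      ∀ (c' : ℝ), c' ≠ 0 → ∀ (w : ℝ), 0 < w → ∀ (χb : PBond P k → ℝ), (∀ b', |χb b'| ≤ 1) →
      ∀ (χ₀ : TSite P 0 → ℝ), (∀ x, |χ₀ x| ≤ 1) →
      (∀ (x : TSite P 0) (b' : PBond P k), χ₀ x ≠ 0 → distEU P k x b'.src ≤ rSched (L : ℝ) ε e r d k / 8 + 2 → χb b' = 1) →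
        Ineq547 (TSite P 0) (PBond P k)
          (fun x b' => χ₀ x * diverg ((P.L : ℝ) ^ k) (fun b : PBond P 0 =>
              w1P (hPd ▸ hd) (rSched (L : ℝ) ε e r d) k χb b b' +
                (WithLp.ofLp (HkE P w c' k (toEj P k (Pi.single b' 1))) b * χb b' -
                  loc (cutoff (rSched (L : ℝ) ε e r d k / 16) (rSched (L : ℝ) ε e r d k / 8)
                      (fun (b : PBond P 0) (b' : PBond P k) => distEU P k b.src b'.src))
                    (fun b b'' => WithLp.ofLp (HkE P w c' k (toEj P k (Pi.single b'' 1))) b) b b')) x)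
          (fun x b' => distEU P k x b'.src) c (rSched (L : ℝ) ε e r d k) := by
  obtain ⟨c, θ₀, ρ₁, hc, -, -, hA⟩ := ineq547_sw1_allTori hd hL
  have hL1 : (1 : ℝ) < (L : ℝ) := by exact_mod_cast hL.2
  refine ⟨c, hc, ?_⟩
  filter_upwards [rSched_threshold_gap hd4 hL1 hr ρ₁ θ₀] with ek hek
  intro P hPd hPL k hk ε e hε he hekk c' hc' w hw χb hχb χ₀ hχ₀ hcollar
  obtain ⟨hρ, hgap⟩ := hek k ε e hε he hekk
  exact hA P hPd hPL k hk (rSched (L : ℝ) ε e r d) hρ hgap c' hc' w hw χb hχb χ₀ hχ₀ hcollar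

end

end Literature.MathematicalPhysics.QuantumFieldTheory.BalabanImbrieJaffe1984to88.BIJ88W1CurlIneq547Torus
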